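import Summits.Ventures.PackingBounds.SphericalCodes.DegreeFourEquality
import Mathlib.LinearAlgebra.Matrix.Nondegenerate
import Mathlib.Data.ZMod.Basic

/-!
# Vectors with pairwise inner products `±1/4`: a parity obstruction, and `A(14, arccos 1/4) ≤ 209`

Framing: lottery ticket; floor = certified bounds/negative ranges. Venture `PackingBounds`
(cell `pub-packcert`), spherical-code family; the last `L − 1` cell of the cell's standard-angle grid,
`(14, 1/4)`, where the integral Delsarte value `210` (quartic certificate `(t+1)(t-1/4)(t+1/4)²`) has
NATURAL valencies `(1, 104, 104)` and an INTEGER eigenvalue ratio, so that neither the valency test nor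
the Larman–Rogers–Seidel test applies; a code of size `210` would be `105` equiangular lines in `ℝ¹⁴` at
angle `arccos 1/4` (Neumann's theorem, Lemmens–Seidel 1973: `1/α` must be odd).

**Lemma (parity).** If unit vectors `v_1, …, v_k` have pairwise inner products `±1/4` and `k` is EVEN,
they are linearly independent: `M = 4·Gram` is an integer matrix congruent mod `2` to `J - I`, and
`(J - I)² = (k-2)J + I ≡ I (mod 2)`, so `det M` is odd, hence nonzero.
(`linearIndependent_of_inner_quarter`.) **Theorem.** `A(14, arccos 1/4) ≤ 209`: at a `210`-point code the
`104` neighbours `y` of a point `x` with `⟨x,y⟩ = 1/4` have pairwise inner products `±1/4`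
(`DegreeFourEquality`: all inner products lie in `{-1, ±1/4}`, and `⟨y,z⟩ = -1` would give
`⟨x,z⟩ = -1/4`), `104` is even, and `104 > 14`. (`code_dim14_quarter_le_209`.) Classical-consequence
row (Neumann / nonexistence of tight 5-designs in `S¹³`, Bannai–Damerell); kernel form new in the tree.

## References
* P. W. H. Lemmens, J. J. Seidel, *Equiangular lines*, J. Algebra 24 (1973) 494–512, Thm. 3.4 (Neumann).
* P. Delsarte, J. M. Goethals, J. J. Seidel, Geom. Dedicata 6 (1977) 363–388. [`DelsarteGoethalsSeidel1977`]
-/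

noncomputable section

namespace Summit.Ventures.PackingBounds.SphericalCodes

open Finset Literature.Analysis.SpecialFunctions Literature.Geometry.DiscreteGeometry
open scoped RealInnerProductSpace

/-- **Parity lemma.** An EVEN number of unit vectors with pairwise inner products in `{1/4, -1/4}` is
linearly independent (`4·Gram ≡ J - I (mod 2)` has odd determinant). [folklore; Neumann's parity
argument, Lemmens–Seidel 1973] -/
theorem linearIndependent_of_inner_quarter {n : ℕ} {ι : Type*} [Fintype ι] [DecidableEq ι]
    (v : ι → EuclideanSpace ℝ (Fin n)) (hunit : ∀ i, ‖v i‖ = 1)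
    (hq : ∀ i j, i ≠ j → inner ℝ (v i) (v j) = 1 / 4 ∨ inner ℝ (v i) (v j) = -1 / 4)
    (heven : Even (Fintype.card ι)) : LinearIndependent ℝ v := by
  classical
  -- the integer matrix `M = 4·Gram`
  set M : Matrix ι ι ℤ := fun i j =>
    if i = j then 4 else if inner ℝ (v i) (v j) = 1 / 4 then 1 else -1 with hMdef
  have hMR : ∀ i j, ((M i j : ℤ) : ℝ) = 4 * inner ℝ (v i) (v j) := by
    intro i j
    rw [hMdef]
    dsimp only
    by_cases hij : i = j
    · subst hij
      rw [if_pos rfl, real_inner_self_eq_norm_sq, hunit i]; norm_num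
    · rw [if_neg hij]
      rcases hq i j hij with h | h
      · rw [if_pos h, h]; norm_num
      · have hne : ¬ inner ℝ (v i) (v j) = 1 / 4 := by rw [h]; norm_num
        rw [if_neg hne, h]; norm_num
  -- reduction mod 2: `M ≡ J - I`
  set φ : ℤ →+* ZMod 2 := Int.castRingHom (ZMod 2) with hφ
  have hM2 : ∀ i j, (M.map φ) i j = if i = j then (0 : ZMod 2) else 1 := by
    intro i j
    rw [Matrix.map_apply, hMdef]
    dsimp only
    by_cases hij : i = j
    · rw [if_pos hij, if_pos hij]; decide
    · rw [if_neg hij, if_neg hij]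
      split_ifs <;> decide
  have hsq : (M.map φ) * (M.map φ) = 1 := by
    ext i j
    rw [Matrix.mul_apply]
    have hterm : ∀ l, (M.map φ) i l * (M.map φ) l j = if (l ≠ i ∧ l ≠ j) then (1 : ZMod 2) else 0 := by
      intro l
      rw [hM2, hM2]
      by_cases h1 : i = l <;> by_cases h2 : l = j <;> simp [h1, h2, eq_comm]
    rw [Finset.sum_congr rfl fun l _ => hterm l, Finset.sum_boole]
    by_cases hij : i = j
    · subst hij
      rw [Matrix.one_apply_eq]
      have hc : (Finset.univ.filter fun l : ι => l ≠ i ∧ l ≠ i).card = Fintype.card ι - 1 := by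
        rw [show (Finset.univ.filter fun l : ι => l ≠ i ∧ l ≠ i) = Finset.univ.erase i from by
          ext l; simp [and_self]]
        rw [Finset.card_erase_of_mem (Finset.mem_univ i), Finset.card_univ]
      rw [hc, ZMod.natCast_eq_one_iff_odd]
      have hpos : 0 < Fintype.card ι := Fintype.card_pos_iff.2 ⟨i⟩
      obtain ⟨m, hm⟩ := heven
      exact ⟨m - 1, by omega⟩
    · rw [Matrix.one_apply_ne hij]
      have hc : (Finset.univ.filter fun l : ι => l ≠ i ∧ l ≠ j).card = Fintype.card ι - 2 := by
        rw [show (Finset.univ.filter fun l : ι => l ≠ i ∧ l ≠ j) = (Finset.univ.erase i).erase j from by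
          ext l; simp [Finset.mem_erase, and_comm]]
        rw [Finset.card_erase_of_mem (Finset.mem_erase.2 ⟨Ne.symm hij, Finset.mem_univ j⟩),
          Finset.card_erase_of_mem (Finset.mem_univ i), Finset.card_univ]
        omega
      rw [hc, ZMod.natCast_eq_zero_iff_even]
      have htwo : 2 ≤ Fintype.card ι := by
        have : Finset.card ({i, j} : Finset ι) = 2 := Finset.card_pair hij
        calc 2 = Finset.card ({i, j} : Finset ι) := this.symm
          _ ≤ Fintype.card ι := Finset.card_le_univ _
      obtain ⟨m, hm⟩ := heven
      exact ⟨m - 1, by omega⟩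
  have hdet2 : (M.map φ).det = 1 := by
    have h := congrArg Matrix.det hsq
    rw [Matrix.det_mul, Matrix.det_one] at h
    -- in ZMod 2, x * x = 1 forces x = 1
    have key : ∀ x : ZMod 2, x * x = 1 → x = 1 := by decide
    exact key _ h
  have hdetZ : M.det ≠ 0 := by
    intro h0
    have h := RingHom.map_det φ M
    rw [h0, map_zero, RingHom.mapMatrix_apply, hdet2] at h
    exact zero_ne_one h
  have hdetR : (M.map (Int.castRingHom ℝ)).det ≠ 0 := by
    have h := RingHom.map_det (Int.castRingHom ℝ) M
    rw [RingHom.mapMatrix_apply] at h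
    rw [← h, eq_intCast]
    exact_mod_cast hdetZ
  -- linear independence via the nonsingular Gram matrix
  rw [Fintype.linearIndependent_iff]
  intro g hg i
  have hmul : (M.map (Int.castRingHom ℝ)).mulVec g = 0 := by
    funext a
    rw [Matrix.mulVec, dotProduct, Pi.zero_apply]
    have : ∑ j, (M.map (Int.castRingHom ℝ)) a j * g j = 4 * inner ℝ (v a) (∑ j, g j • v j) := by
      rw [inner_sum, Finset.mul_sum]
      refine Finset.sum_congr rfl fun j _ => ?_
      rw [Matrix.map_apply, eq_intCast, hMR, real_inner_smul_right]; ring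
    rw [this, hg, inner_zero_right, mul_zero]
  have := Matrix.eq_zero_of_mulVec_eq_zero hdetR hmul
  exact congrFun this i

/-- **`A(14, arccos 1/4) ≤ 209`**: every finite set of unit vectors of `ℝ^14` with pairwise inner
products `≤ 1/4` has at most `209` elements. The certified Delsarte value `210` (quartic certificate
`(t + 1)(t - 1/4)(t + 1/4)²`) is not attained: the `104` neighbours at inner product `1/4` of any point of
a `210`-code would be `104 > 14` linearly independent vectors (pairwise inner products `±1/4`, parity
lemma). (LP equality case + Neumann-type parity; certified `L − 1` row of the `pub-packcert` grid;
classical: no tight 5-design / 105 equiangular lines in `ℝ¹⁴`.) -/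
theorem code_dim14_quarter_le_209 (C : Finset (EuclideanSpace ℝ (Fin 14)))
    (h1 : ∀ x ∈ C, ‖x‖ = 1) (h2 : ∀ x ∈ C, ∀ y ∈ C, x ≠ y → inner ℝ x y ≤ 1 / 4) :
    C.card ≤ 209 := by
  classical
  set f : ℕ → ℝ := fun k => match k with
      | 0 => 5 / 448
      | 1 => 5 / 384
      | 2 => 25 / 4032
      | 3 => 5 / 1792
      | 4 => 1 / 2016
      | _ => 0 with hfdef
  have hfac : ∀ t : ℝ, ∑ k ∈ range (4 + 1), f k * gegenbauerSum (6 : ℝ) k t =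
      (t + 1) * (t - 1 / 4) * (t + 1 / 4) ^ 2 := by
    intro t
    simp [hfdef, Finset.sum_range_succ, gegenbauerSum, gegenbauerCoeff, Finset.prod_range_succ,
      Nat.factorial]
    ring
  have hf : ∀ k, 0 ≤ f k := by intro k; simp only [hfdef]; split <;> norm_num
  have hn : ((14 : ℕ) : ℝ) = 2 * (6 : ℝ) + 2 := by norm_num
  have hμ : (0 : ℝ) < 6 := by norm_num
  have hF : ∀ t : ℝ, -1 ≤ t → t ≤ 1 / 4 → ∑ k ∈ range (4 + 1), f k * gegenbauerSum (6 : ℝ) k t ≤ 0 := by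
    intro t ht1 ht2
    rw [hfac]
    have : (t + 1) * (t - 1 / 4) ≤ 0 := mul_nonpos_of_nonneg_of_nonpos (by linarith) (by linarith)
    exact mul_nonpos_of_nonpos_of_nonneg this (sq_nonneg _)
  have hle := DelsarteLP.card_mul_le hn hμ 4 f hf (1 / 4) hF C h1 h2
  rw [hfac] at hle
  have hf0 : f 0 = 5 / 448 := rfl
  rw [hf0] at hle
  have hC : C.card ≤ 210 := by
    have : (C.card : ℝ) ≤ 210 := by nlinarith
    exact_mod_cast this
  rcases hC.lt_or_eq with hlt | heqN
  · omega
  exfalso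
  obtain ⟨x, hx⟩ := Finset.card_pos.1 (by omega : 0 < C.card)
  have heq' : (C.card : ℝ) * f 0 = ∑ k ∈ range (4 + 1), f k * gegenbauerSum (6 : ℝ) k 1 := by
    rw [hfac, heqN, hf0]; norm_num
  have heq : (C.card : ℝ) * f 0 = 2 * (1 - 1 / 4) * (1 + 1 / 4) ^ 2 := by
    rw [heqN, hf0]; norm_num
  -- all inner products of distinct points lie in {-1, 1/4, -1/4}
  have hroots : ∀ y ∈ C, ∀ z ∈ C, y ≠ z →
      inner ℝ y z = -1 ∨ inner ℝ y z = 1 / 4 ∨ inner ℝ y z = -1 / 4 := by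
    intro y hy z hz hyz
    have h0 := DelsarteLP.sum_eq_zero_of_card_mul_eq hn hμ 4 f hf (1 / 4) hF C h1 h2 heq' hy hz hyz
    rw [hfac] at h0
    rcases mul_eq_zero.1 h0 with h | h
    · rcases mul_eq_zero.1 h with h' | h'
      · left; linarith
      · right; left; linarith
    · right; right
      have := pow_eq_zero_iff (n := 2) (by norm_num) |>.1 h
      linarith
  -- valencies at x: m = 1, A = B = 104
  obtain ⟨hm, hc, hb, hd⟩ := degree_four_valency hn hμ (1 / 4) (1 / 4) (by norm_num) (by norm_num)
    (by norm_num) f hf (by rw [hfdef]; norm_num) (by rw [hfdef]; norm_num) hfac C h1 h2 heq hx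
  rw [heqN] at hc hd
  set S := (C.erase x).filter fun y => inner ℝ x y = 1 / 4 with hS
  have hScard : S.card = 104 := by
    set mm := ((C.erase x).filter fun y => inner ℝ x y = -1).card with hmm
    set B := ((C.erase x).filter fun y => inner ℝ x y = -(1 / 4 : ℝ)).card with hB
    have hc' : (mm : ℝ) + S.card + B + 1 = 210 := by exact_mod_cast hc
    norm_num at hb hd
    interval_cases mm
    · exfalso; norm_num at hb hd hc'; linarith
    · norm_num at hb hd hc'
      have : (S.card : ℝ) = 104 := by linarith
      exact_mod_cast this
  -- the family `S → ℝ¹⁴` has pairwise inner products ±1/4 and even cardinality: independent, too many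
  have hq : ∀ i j : S, i ≠ j → inner ℝ (i : EuclideanSpace ℝ (Fin 14)) (j : EuclideanSpace ℝ (Fin 14)) = 1 / 4 ∨
      inner ℝ (i : EuclideanSpace ℝ (Fin 14)) (j : EuclideanSpace ℝ (Fin 14)) = -1 / 4 := by
    intro i j hij
    have hi := Finset.mem_filter.1 i.2
    have hj := Finset.mem_filter.1 j.2
    have hiC := Finset.mem_of_mem_erase hi.1
    have hjC := Finset.mem_of_mem_erase hj.1
    have hne : (i : EuclideanSpace ℝ (Fin 14)) ≠ (j : EuclideanSpace ℝ (Fin 14)) :=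
      fun h => hij (Subtype.ext h)
    rcases hroots _ hiC _ hjC hne with h | h | h
    · exfalso
      have hzi := eq_neg_of_inner_eq_neg_one (h1 _ hiC) (h1 _ hjC) h
      have : inner ℝ x (j : EuclideanSpace ℝ (Fin 14)) = -(1 / 4 : ℝ) := by
        rw [hzi, inner_neg_right, hi.2]
      rw [hj.2] at this; norm_num at this
    · exact Or.inl h
    · exact Or.inr h
  have hli := linearIndependent_of_inner_quarter (fun i : S => (i : EuclideanSpace ℝ (Fin 14)))
    (fun i => h1 _ (Finset.mem_of_mem_erase (Finset.mem_filter.1 i.2).1)) hq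
    (by rw [Fintype.card_coe, hScard]; exact ⟨52, by norm_num⟩)
  have hcard := hli.fintype_card_le_finrank
  rw [Fintype.card_coe, hScard, finrank_euclideanSpace, Fintype.card_fin] at hcard
  omega

end Summit.Ventures.PackingBounds.SphericalCodes

end
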